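import Literature.Computability.AlgebraicComplexity.DegenerationSpectralMonotone
import Literature.Computability.AlgebraicComplexity.MatrixMultiplicationExponent
import Literature.Computability.AlgebraicComplexity.BorderRankCW
import HarnessLib

/-!
# Alman–Li 2026: the iterated speedup identity for powers of the little Coppersmith–Winograd tensor

Topic `Literature/Computability/AlgebraicComplexity`. ONE NAMED FACT (stated, not proved here) from
J. Alman, B. Li, *Asymptotic Rank Speedup Theorems, Revisited*, arXiv:2605.21738 (20 May 2026), read from
the held text `paper:arxiv-2605.21738`, §7.1 (chunk p0017) with Theorem 6.2 (p0015) and Proposition 5.1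
(p0010–p0011); sibling of `AlmanLi2026SmallCW.lean` (Thm. 1.3 / Cor. 7.1 as named facts) and of
`OneSliceSpeedup.lean` (the weak one-slice speedup, proved).

## The printed claim

§7.1, display after Corollary 7.1 (p0017): "We can further apply the second method to iteratively speed
up the degeneration. By Theorem 6.2, we obtain
`cw_q^{⊗2n} ⊕ 2 ⊙ cw_q^{⊗n} ⊗ ⟨1, (q+2)^n − 2(q+1)^n + q^n, 1⟩ ⊕ ⟨1, [(q+2)^n − 2(q+1)^n + q^n]² + 2(q+1)^{2n}, 1⟩
 ⊴ (⟨(q+2)^n⟩ ⊕ ⟨1, q^n, 1⟩)^{⊗2}`.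
Strassen calculus then gives the upper bound `R̃(cw_q) ≤ max_{θ ∈ [2/3,1]} F(θ)` where
`F(θ) := √((r + s^θ)² − (t² + 2(q+1)^{2n})^θ + t^{2θ}) − t^θ` with `r = (q+2)^n`, `s = q^n`,
`t = r + s − 2(q+1)^n`."  Here Theorem 6.2 (p0015) is: under the setting of the one-slice speedup
Theorem 6.1 (`T ⊕ ⟨1,t,1⟩ ⊴ ⟨r⟩ ⊕ ⟨1,s,1⟩`, `t = r + s − 2·dim`), "there exists a degeneration
`T^{⊗2} ⊕ 2 ⊙ T ⊗ ⟨1,t,1⟩ ⊕ ⟨1, t² + 2n², 1⟩ ⊴ ⟨r²⟩ ⊕ 2r ⊙ ⟨1,s,1⟩ ⊕ ⟨1,s²,1⟩`", and the slack data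
`s = q^n` for `T = cw_q^{⊗n} ⊴ ⟨(q+2)^n⟩` is Lemma 7.1 / Proposition 7.1 (a functional on one factor of the
Coppersmith–Winograd border-rank identity making `∑ c'_i a_i b_i` of rank `q`).

## What is recorded, and the reading choices

* `AlmanLi2026_iteratedSpeedup_cw` — the displayed degeneration, for `q ≥ 2`, `n ≥ 1`, in the regime
  `2(q+1)^n < (q+2)^n` (equivalently `t > s`, the only regime in which the paper draws asymptotic-rank
  consequences from it, Thm. 6.1 "when `r > 2n`"), with `t` introduced by the equation
  `(q+2)^n + q^n = 2(q+1)^n + t` (no truncated subtraction), and IN THE THREE DIRECTIONS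
  `⟨1,·,1⟩`, `⟨1,1,·⟩`, `⟨·,1,1⟩`: the display is written for `⟨1,·,1⟩`; the evaluation
  "`max_{θ ∈ [2/3,1]}`" that follows it in the paper is Proposition 5.1 (eqs. (degen1)–(degen3), p0011:
  the relation in all three directions and `θ₁ + θ₂ + θ₃ ≥ 2`), the other two directions being the same
  construction with the functional of Lemma 7.1 placed on another factor — `cw_q` and the
  Coppersmith–Winograd decomposition are invariant under permuting the three factors.
* Dictionary: `cw_q = cwTensor K q` (`BorderRankCW.lean`, format `(q+1)³`); `⟨k,m,n⟩ = matMulTensor K k m n`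
  (`MatrixMultiplicationExponent.lean`; `⟨1,m,1⟩` is the one-slice tensor of §5.3, `≅ oneSliceTensor K (Fin m)`
  of `OneSliceSpeedup.lean`); `⟨r⟩ = unitTensor K r`; `⊕ = directSumTensor`, `⊗ = kroneckerTensor`,
  `X^{⊗N} = kroneckerPow X N`, `2 ⊙ X` rendered as `⟨2⟩ ⊗ X (≅ X ⊕ X)`, the tensor square on the right as
  `S ⊗ S`; `Y ⊴ X` is `AlgDegeneratesTo X Y` (`DegenerationSpectralMonotone.lean`, BCS (15.19)).
* Stated over `ℂ` (the paper fixes an arbitrary field for §5–6; the Coppersmith–Winograd identity of §7.1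
  is used as printed).

What is deliberately NOT here: Theorems 6.1–6.3 in their general form (they quantify over border-rank
decompositions with chosen functionals, "full" and "isolated" slices), the un-iterated Prop. 7.1 (its
consequence Cor. 7.1 is the named fact `AlmanLi2026_asymptoticRank_cw_le_gamma`), the numerical table
(Table 1: `γ'_2 = 3.931` at `n = 4`), and any evaluation of the bound — consequences for `R̃(cw_2)` are
problem-side (`Summits/MatrixMultiplication`).
-/

namespace Literature.Computability.AlgebraicComplexity

/-- **Alman–Li 2026, §7.1 (display after Cor. 7.1) = Theorem 6.2 applied to Proposition 7.1**, in the
three directions of Proposition 5.1.  For `q ≥ 2`, `n ≥ 1` with `2(q+1)^n < (q+2)^n`, writing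
`r = (q+2)^n`, `s = q^n`, `(q+2)^n + q^n = 2(q+1)^n + t` and `t' = t² + 2(q+1)^{2n}`:
`cw_q^{⊗2n} ⊕ ⟨2⟩ ⊗ (cw_q^{⊗n} ⊗ ⟨1,t,1⟩) ⊕ ⟨1,t',1⟩ ⊴ (⟨r⟩ ⊕ ⟨1,s,1⟩) ⊗ (⟨r⟩ ⊕ ⟨1,s,1⟩)`,
and the same with `⟨1,1,·⟩` and with `⟨·,1,1⟩` in place of `⟨1,·,1⟩` throughout.
Named fact, not proved here. [cite: AlmanLi2026, §7.1 (Thm 6.2 + Prop 7.1)] -/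
def AlmanLi2026_iteratedSpeedup_cw : Prop :=
  ∀ q n t : ℕ, 2 ≤ q → 1 ≤ n → 2 * (q + 1) ^ n < (q + 2) ^ n →
    (q + 2) ^ n + q ^ n = 2 * (q + 1) ^ n + t →
    -- direction ⟨1,·,1⟩
    AlgDegeneratesTo
      (kroneckerTensor
        (directSumTensor (unitTensor ℂ ((q + 2) ^ n)) (matMulTensor ℂ 1 (q ^ n) 1))
        (directSumTensor (unitTensor ℂ ((q + 2) ^ n)) (matMulTensor ℂ 1 (q ^ n) 1)))
      (directSumTensor (kroneckerPow (cwTensor ℂ q) (2 * n))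
        (directSumTensor
          (kroneckerTensor (unitTensor ℂ 2)
            (kroneckerTensor (kroneckerPow (cwTensor ℂ q) n) (matMulTensor ℂ 1 t 1)))
          (matMulTensor ℂ 1 (t ^ 2 + 2 * (q + 1) ^ (2 * n)) 1))) ∧
    -- direction ⟨1,1,·⟩
    AlgDegeneratesTo
      (kroneckerTensor
        (directSumTensor (unitTensor ℂ ((q + 2) ^ n)) (matMulTensor ℂ 1 1 (q ^ n)))
        (directSumTensor (unitTensor ℂ ((q + 2) ^ n)) (matMulTensor ℂ 1 1 (q ^ n))))
      (directSumTensor (kroneckerPow (cwTensor ℂ q) (2 * n))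
        (directSumTensor
          (kroneckerTensor (unitTensor ℂ 2)
            (kroneckerTensor (kroneckerPow (cwTensor ℂ q) n) (matMulTensor ℂ 1 1 t)))
          (matMulTensor ℂ 1 1 (t ^ 2 + 2 * (q + 1) ^ (2 * n))))) ∧
    -- direction ⟨·,1,1⟩
    AlgDegeneratesTo
      (kroneckerTensor
        (directSumTensor (unitTensor ℂ ((q + 2) ^ n)) (matMulTensor ℂ (q ^ n) 1 1))
        (directSumTensor (unitTensor ℂ ((q + 2) ^ n)) (matMulTensor ℂ (q ^ n) 1 1)))
      (directSumTensor (kroneckerPow (cwTensor ℂ q) (2 * n))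
        (directSumTensor
          (kroneckerTensor (unitTensor ℂ 2)
            (kroneckerTensor (kroneckerPow (cwTensor ℂ q) n) (matMulTensor ℂ t 1 1)))
          (matMulTensor ℂ (t ^ 2 + 2 * (q + 1) ^ (2 * n)) 1 1)))

end Literature.Computability.AlgebraicComplexity
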